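import Summits.CriticalPhenomena.PercolationContinuityZ3.Theorems.PercNearOneGluingNoHeavyLowerTailQ7PsiZDual
import HarnessLib

/-!
# `NoHeavyLowerTail` (stmt-CriticalPhenomena-4575) — the weak-relay duality for an ARBITRARY weight on the owner's cluster
# (the k-free form of `Q7Psi.zhalf_of_xhalf`, for the |A| ≥ 4 certificates)

Support file (`--supports stmt-CriticalPhenomena-4575`), coupling seat `prim-cplus-coupling` (gen 9).  No definitions, no named
facts, no sorries.

For the (GΨ_k) certificates with k ≥ 4 relays (seat memo prim-cplus-coupling/Q7-FOUR-RELAYS.md §1) each observer half is an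
inequality `∫_{x↮z} G(C x) · h(C_x) ≥ 0` for every monotone `G`, where `h` is a fixed (signed) weight on the owner's open EDGE cluster
(a combination of pattern indicators minus a constant).  The weak-relay half is then AUTOMATIC, for every such `h`:

* `Q7Psi.tower_weak_weight` — weighted tower property on `{x ↮ z}` (vdBHK Lemma 2.4):
  `∫_{x↮z} F(C z) · h(C_x) = ∫_{x↮z} k(C(x)) · h(C_x)`, `k(S) = ∫ F(C_z(η ∖ {pairs meeting S})) dμ(η)`;
* `Q7Psi.zdual_weight` — **duality**: if `0 ≤ ∫_{x↮z} G(C x) · h(C_x)` for every monotone `G`, then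
  `∫_{x↮z} F(C z) · h(C_x) ≤ 0` for every monotone `F` (apply the hypothesis to `G = −k`, which is monotone).
(`Q7Psi.zhalf_of_xhalf` is the case `h = 𝟙{o∈C, y∉C} + t·𝟙{o,y∈C} − λ`.)
[cite: VandenbergHaggstromKahn2005, §2.1 Lemma 2.4 (p. 10)] [cite: KozmaNitzan2024, §5.1 (pp. 31–32), Question 7 (p. 36)]
-/

namespace Summit.CriticalPhenomena.PercolationContinuityZ3.Theorems

open MeasureTheory Set Literature.Probability.LatticeModels Literature.Probability.Percolation
open scoped Classical
open KNPreFKG BHK2006 DecisionTree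

noncomputable section

namespace Q7Psi

variable {V : Type*} [Fintype V]

/-- **Weighted tower property along `σ(C_x)` on `{x ↮ z}`** (vdBHK Lemma 2.4): for any `F` on vertex sets and any weight `h` on
edge sets, `∫_{x↮z} F(C z)·h(C_x) dμ = ∫_{x↮z} k(C(x))·h(C_x) dμ` with `k(S) = ∫ F(C_z(η ∖ {pairs meeting S})) dμ(η)` — given
`C_x` (inside `{x ↮ z}`) the cluster of `z` is the cluster of `z` for fresh percolation off the pairs meeting `C(x)`.
[cite: VandenbergHaggstromKahn2005, §2.1 Lemma 2.4 (p. 10)] -/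
theorem tower_weak_weight (w : Sym2 V → unitInterval) (x z : V) (F : Set V → ℝ) (h : Set (Sym2 V) → ℝ) :
    ∫ ω in {ω : BondConfig V | ¬ (openGraph ω).Reachable x z},
        F (openCluster ω z) * h (openEdgeCluster ω x) ∂(prodBernoulli w) =
      ∫ ω in {ω : BondConfig V | ¬ (openGraph ω).Reachable x z},
        (∫ η, F (openCluster (η \ {e : Sym2 V | ∃ v ∈ e, v ∈ openCluster ω x}) z) ∂(prodBernoulli w)) *
          h (openEdgeCluster ω x) ∂(prodBernoulli w) := by
  classical
  set μ := prodBernoulli w with hμ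
  set D : Set (BondConfig V) := {ω : BondConfig V | ¬ (openGraph ω).Reachable x z} with hD
  have hDiff : ∀ ω : BondConfig V, ω ∈ D ↔ ∀ s ∈ ({x} : Set V), ∀ t ∈ ({z} : Set V),
      ¬ (openGraph ω).Reachable s t := by
    intro ω; simp [hD]
  have hm : ∑ ω : Set (Sym2 V), weight (fun e => (w e : ℝ)) ω = 1 := by
    have h1 := integral_prodBernoulli_eq_sum w fun _ => (1 : ℝ)
    simp only [integral_const, probReal_univ, smul_eq_mul, mul_one] at h1
    exact h1.symm
  -- the two-cluster identity with `H(K, L) = h(K) · F(V_z(L))`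
  have key := set_sum_cond_cluster (fun e => (w e : ℝ)) hm ({x} : Set V) ({z} : Set V)
    (fun K L => h K * F {a | a = z ∨ ∃ e ∈ L, a ∈ e}) hDiff
  simp only [setCl_singleton] at key
  have hvert : ∀ η : BondConfig V, F {a | a = z ∨ ∃ e ∈ openEdgeCluster η z, a ∈ e} = F (openCluster η z) :=
    fun η => clusterFun_openEdgeCluster F η z
  simp only [hvert] at key
  -- `barOf {x} (C_x ω)` is the set of pairs meeting `C(x)`
  have hbar : ∀ ω : BondConfig V, barOf {x} (openEdgeCluster ω x) = {e : Sym2 V | ∃ v ∈ e, v ∈ openCluster ω x} :=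
    fun ω => barOf_openEdgeCluster_eq ω x
  rw [← integral_indicator (MeasurableSet.of_discrete), ← integral_indicator (MeasurableSet.of_discrete),
    integral_prodBernoulli_eq_sum, integral_prodBernoulli_eq_sum]
  have hL : ∀ ω : BondConfig V, D.indicator (fun ω => F (openCluster ω z) * h (openEdgeCluster ω x)) ω =
      h (openEdgeCluster ω x) * F (openCluster ω z) * ind D ω := by
    intro ω
    by_cases h1 : ω ∈ D
    · rw [indicator_of_mem h1, ind_of_mem h1]; ring
    · rw [indicator_of_notMem h1, ind_of_not_mem h1]; ring
  have hR : ∀ ω : BondConfig V, D.indicator (fun ω =>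
      (∫ η, F (openCluster (η \ {e : Sym2 V | ∃ v ∈ e, v ∈ openCluster ω x}) z) ∂μ) * h (openEdgeCluster ω x)) ω =
      (∑ η : Set (Sym2 V), weight (fun e => (w e : ℝ)) η *
        (h (openEdgeCluster ω x) * F (openCluster (η \ barOf {x} (openEdgeCluster ω x)) z))) * ind D ω := by
    intro ω
    have hint : ∫ η, F (openCluster (η \ {e : Sym2 V | ∃ v ∈ e, v ∈ openCluster ω x}) z) ∂μ =
        ∑ η : Set (Sym2 V), weight (fun e => (w e : ℝ)) η *
          F (openCluster (η \ barOf {x} (openEdgeCluster ω x)) z) := by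
      rw [integral_prodBernoulli_eq_sum]; simp only [hbar]
    by_cases h1 : ω ∈ D
    · rw [indicator_of_mem h1, ind_of_mem h1, hint, mul_one, mul_comm, Finset.mul_sum]
      refine Finset.sum_congr rfl fun η _ => ?_
      ring
    · rw [indicator_of_notMem h1, ind_of_not_mem h1]; ring
  simp only [hL, hR]
  exact key

/-- **Weak-relay duality for an arbitrary weight on the owner's cluster.**  If `0 ≤ ∫_{x↮z} G(C x)·h(C_x) dμ` for every
monotone cluster property `G`, then `∫_{x↮z} F(C z)·h(C_x) dμ ≤ 0` for every monotone `F`.  (Tower along `σ(C_x)`: the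
conditional mean of `F(C z)` is a DECREASING function of `C(x)` (`Q7Psi.condMean_antitone`); apply the hypothesis to its negative.)
This gives the weak-relay part of every (GΨ_k) certificate from its observer halves (seat memo Q7-FOUR-RELAYS.md §1, Lemma 2).
[cite: VandenbergHaggstromKahn2005, §2.1 Lemma 2.4 (p. 10)] [cite: KozmaNitzan2024, §5.1 (pp. 31–32)] -/
theorem zdual_weight (w : Sym2 V → unitInterval) (x z : V) (h : Set (Sym2 V) → ℝ) (F : Set V → ℝ)
    (hF : ∀ S T : Set V, S ⊆ T → F S ≤ F T)
    (hP : ∀ G : Set V → ℝ, (∀ S T : Set V, S ⊆ T → G S ≤ G T) →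
      0 ≤ ∫ ω in {ω : BondConfig V | ¬ (openGraph ω).Reachable x z},
        G (openCluster ω x) * h (openEdgeCluster ω x) ∂(prodBernoulli w)) :
    ∫ ω in {ω : BondConfig V | ¬ (openGraph ω).Reachable x z},
        F (openCluster ω z) * h (openEdgeCluster ω x) ∂(prodBernoulli w) ≤ 0 := by
  classical
  set μ := prodBernoulli w with hμ
  set G : Set V → ℝ := fun S => - ∫ η, F (openCluster (η \ {e : Sym2 V | ∃ v ∈ e, v ∈ S}) z) ∂μ with hG
  have hGmono : ∀ S T : Set V, S ⊆ T → G S ≤ G T := fun S T hST =>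
    neg_le_neg (condMean_antitone w z F hF S T hST)
  have key := hP G hGmono
  rw [hμ, tower_weak_weight w x z F h]
  have e : ∫ ω in {ω : BondConfig V | ¬ (openGraph ω).Reachable x z},
      (∫ η, F (openCluster (η \ {e : Sym2 V | ∃ v ∈ e, v ∈ openCluster ω x}) z) ∂(prodBernoulli w)) *
        h (openEdgeCluster ω x) ∂(prodBernoulli w) =
      - ∫ ω in {ω : BondConfig V | ¬ (openGraph ω).Reachable x z},
        G (openCluster ω x) * h (openEdgeCluster ω x) ∂(prodBernoulli w) := by
    rw [← integral_neg]
    refine setIntegral_congr_fun MeasurableSet.of_discrete fun ω _ => ?_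
    simp only [hG, hμ, neg_mul, neg_neg]
  rw [e]
  linarith

end Q7Psi

end

end Summit.CriticalPhenomena.PercolationContinuityZ3.Theorems
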